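import Literature.MathematicalPhysics.QuantumManyBody.LiebSimpleEquationDecayErratum
import Literature.MathematicalPhysics.QuantumManyBody.LiebSimpleEquationExistence
import HarnessLib

/-!
# Lieb's simple equation: the refuted CJL-II facts, unconditionally, and the paper's own cross-check

Topic: `Literature/MathematicalPhysics/QuantumManyBody`. A short capstone over
`LiebSimpleEquationFacts.lean` (the named facts of CJL-I/II), `LiebSimpleEquationExistence.lean`
(`CarlenJauslinLieb2020_thm1_holds`: CJL-I Theorem 1 is a theorem of the tree),
`LiebSimpleEquationDecayErratum.lean` (`not_CarlenJauslinLieb2021_thm2_of_thm1`: CJL-I Theorem 1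
refutes CJL-II Theorem 2 as printed) and `LiebSimpleEquationPinned.lean`
(`not_CarlenJauslinLieb2021_thm6_of_thm1`). CJL-I = Carlen–Jauslin–Lieb, Pure Appl. Anal. 2
(2020) 659–684, arXiv:1912.04987; CJL-II = SIAM J. Math. Anal. 53 (2021) 5322–5360,
arXiv:2010.13882 (theorem numbers and equation labels of the arXiv version).

## Contents

* `not_CarlenJauslinLieb2021_thm2` — **CJL-II Theorem 2 AS PRINTED is false** (tail coefficient
  `√(2+β)/(2π²√e)` with the printed (betadef) `β = ρ∫|x|²v(1 − u)`): the composition of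
  `not_CarlenJauslinLieb2021_thm2_of_thm1` with `CarlenJauslinLieb2020_thm1_holds`;
  `exists_isSolution_not_memLp_two_decayRemainder` pins the false conjunct (the `L²` clause on
  `|x|⁴R`, for the indicator of the unit ball at `e = 1`). The printed theorem is stated VERBATIM IN
  THE TYPE of `not_CarlenJauslinLieb2021_thm2` (the tree's rendering: `IsWeightedPotential`,
  `decayBeta`, `decayRemainder`, the pointwise bound in division-free form), so that the record of
  the printed text does not depend on a named fact: the verbatim transcription was first vendored
  as the named fact `CarlenJauslinLieb2021_thm2` of the facts file and, once refuted, is retired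
  from the fact list (D-0014: a false `Prop` must not be offered as a hypothesis) — the same
  history as CJL-II Theorem 3 (`LiebSimpleEquationErratum.lean`).
  Verdict on the fact (review of 2026-08-15 with the source open at Theorem 2, §2 and §10):
  MISSTATED IN PRINT by a factor `3` in `β`. The proof (§2) works throughout with
  `β := −(ρ/4e)∂²_κŜ(0)`, `κ = |k|/(2√e)`, and establishes the tail `√(2+β)/(2π²√e)` for THAT
  `β` ((U1hat), (U1decay)); for the radial `S = v(1 − u)` on `ℝ³`,
  `Ŝ(k) = ∫e^{ikx}S = Ŝ(0) − (|k|²/6)∫|x|²S + O(|k|⁴)`, so the proof's `β` is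
  `(ρ/3)∫|x|²v(1 − u)`, one third of (betadef) (`integral_inner_sq_mul_eq_of_radial` in the facts
  file; `IsSolution.tail_coefficient_eq` in the decay-erratum file derives the constant from the
  equation). The established statement is Theorem 2 with the coefficient `√(2 + β/3)/(2π²√e)`
  (`correctedDecayCoeff`, `correctedDecayRemainder`; recorded as text in the facts file, §"the
  printed versus the established tail" — not a named fact: it has no consumer, and its `L²`/`L^∞`
  and pointwise clauses are the whole of CJL-II §2). The other printed clauses are unaffected:
  `β ≤ ρ‖x²v‖₁` is the theorem `IsSolution.decayBeta_le`, the `L^∞` clause does not see the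
  constant (`memLp_top_decayRemainder_iff`). The printed closed form of `β` is reproduced
  unchanged in the later expositions [Jauslin2022, Theorem 4.4] and [Jauslin2025, Lemma 6.8]
  (both refer to CJL-II §2 for the proof); no published correction is known to the tree
  (searched 2026-08-15), so the erratum rests on the tree's three certified lines of evidence:
  the spherical average (facts file), the Fourier-space derivation of the constant
  (decay-erratum file) and the explicit solution (below).
* `not_CarlenJauslinLieb2021_thm6` — likewise for the tree's first rendering of CJL-II Theorem 6
  (degenerate two-sided `η`; `not_CarlenJauslinLieb2021_thm6_of_thm1`, `LiebSimpleEquationPinned.lean`,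
  composed with `CarlenJauslinLieb2020_thm1_holds`). As for Theorem 2, the refuted rendering is stated
  VERBATIM IN THE TYPE: it was first vendored as the named fact `CarlenJauslinLieb2021_thm6` of the
  facts file and, once refuted, is retired from the fact list (verdict clean-up of 2026-08-15; the
  corrected rendering — right `μ`-derivative of the pinned energy along a pinned branch, asymptotics
  of `etaFormula` — is recorded there in Lean, to be vendored as `CarlenJauslinLieb2021_thm6_rightDeriv`
  by a definition or cite seat).
* **The paper's own cross-check, certified.** CJL-II Theorem 8 and §10 exhibit the explicit
  solution `u = c/(1 + b²x²)²` with `ρ = b³/(cπ²)` ((rho)), for `e/b² ≥ 7/9`, `c ≤ 1` and an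
  explicit rational potential `v ≥ 0` ((v_explicit); `(1 + |x|²)v ∈ L¹`, `∫|x|⁴v = ∞`). §10
  computes from (betadef) `β = 6(2e − b²)/b²` ((beta_explicit)) and observes that the printed
  tail `√(2+β)/(2π²ρ√e x⁴) = (c/(b⁴x⁴))√(3 − b²/e)` ((asymupred)) matches the true asymptotics
  `u ∼ c/(b⁴x⁴)` ((asymu)) "if and only if `2e = b²`, but then the potential is negative for large
  `|x|`", reading the mismatch as a limitation of Theorem 2. With `β/3` there is no mismatch:
  `2 + β/3 = 4e/b²` and `√(4e/b²)/(2π²ρ√e) = c/b⁴` for EVERY `(e, b, c)` —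
  `explicitSolution_correctedDecayCoeff_eq`; and the printed coefficient matches only on the
  excluded line — `explicitSolution_decayCoeff_eq_iff`. These two theorems are real arithmetic on
  the three printed values `ρ`, `β`, `c/b⁴`; they do not re-derive them from `u` and `v`.
  (Numerically, by quadrature of the printed `u`, `v` at `b = 1` for `e ∈ {7/9, 1, 2, 5}`: the
  energy constraint `e = (ρ/2)∫(1 − u)v` and `β = 6(2e − 1)` are reproduced to `10⁻⁹`, and the
  true coefficient `1/π² = 0.1013212` of `ρu` agrees with `√(2 + β/3)/(2π²√e)` to nine digits,
  while `√(2 + β)/(2π²√e) = 0.1327, 0.1433, 0.1602, 0.1695`.)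

## References

* [CarlenJauslinLieb2021] E. A. Carlen, I. Jauslin, E. H. Lieb, *Analysis of a simple equation for
  the ground state of the Bose gas II: monotonicity, convexity, and condensate fraction*, SIAM J.
  Math. Anal. 53 (2021) 5322–5360, arXiv:2010.13882: Theorem 2 with (betadef); §2 ((kappa),
  "`β = −(ρ/4e)∂²_κŜ`", (U1hat), (U1decay)); Theorem 6; Theorem 8 and §10 ((rho),
  (v_explicit), (beta_explicit), (asymu), (asymupred)).
* [CarlenJauslinLieb2020] E. A. Carlen, I. Jauslin, E. H. Lieb, *Analysis of a simple equation for
  the ground state energy of the Bose gas*, Pure Appl. Anal. 2 (2020) 659–684, arXiv:1912.04987: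
  Theorem 1.
* [Jauslin2022] I. Jauslin, *Review of a simplified approach to study the Bose gas at all
  densities*, in: The Physics and Mathematics of Elliott Lieb, EMS Press (2022), arXiv:2202.07637:
  Theorem 4.4 ((4.3)–(4.4)).
* [Jauslin2025] I. Jauslin, *An Introduction to Lieb's Simplified Approach to the Bose Gas*,
  SpringerBriefs in Physics (2025), arXiv:2308.00290: Lemma 6.8 ((6.123)–(6.125)).
-/

noncomputable section

open MeasureTheory Filter Set
open scoped ENNReal Topology

namespace Literature.MathematicalPhysics.QuantumManyBody

namespace LiebSimpleEquation

open BoseGas (Space)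

/-! ## The two refuted statements -/

/-- **CJL-II Theorem 2 as printed is false.** The printed theorem — "If
`(1 + |x|⁴)v ∈ L¹(ℝ³) ∩ L²(ℝ³)`, then `ρu(x) = √(2+β)/(2π²√e)·|x|⁻⁴ + R(x)` where
`β = ρ∫|x|²v(1 − u)dx ≤ ρ‖x²v‖₁`, and where `|x|⁴R(x)` is in `L²(ℝ³) ∩ L^∞(ℝ³)`, uniformly in `e`
on all compact sets. Moreover, for every `ρ₀ > 0`, there is a constant `C` that only depends on
`ρ₀` such that for all `x`, for all `ρ < ρ₀`, `u(x) ≤ min{1, C/(ρe^{1/2}|x|⁴)}`" — is stated here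
verbatim in the tree's rendering (solution triples `(ρ, e, u)`, `ρ, e > 0`, of the simple equation
with a CJL-II potential `v ≥ 0` radial, `v ≢ 0`; `β = decayBeta`, `R = decayRemainder` with the
printed coefficient `decayCoeff = √(2+β)/(2π²√e)`; the pointwise bound in the division-free form
`ρ√e|x|⁴u(x) ≤ C`; the uniformity of the remainder norms in `e` not recorded — exactly the body of
the retired named fact `CarlenJauslinLieb2021_thm2`), and REFUTED outright: CJL-I Theorem 1 holds
(`CarlenJauslinLieb2020_thm1_holds`) and refutes it (`not_CarlenJauslinLieb2021_thm2_of_thm1`: the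
`L²` clause fails for the even solution triple of `v = 𝟙_{|x| ≤ 1}` at `e = 1`). The defect is the
factor `3` in the printed closed form (betadef) of `β` (the proof's `β = −(ρ/4e)∂²_κŜ(0)` is
`(ρ/3)∫|x|²v(1 − u)`); the clause `β ≤ ρ‖x²v‖₁` (`IsSolution.decayBeta_le`), the `L^∞` clause
(`memLp_top_decayRemainder_iff`) and the pointwise bound are not affected, and the established
statement carries `correctedDecayCoeff = √(2 + β/3)/(2π²√e)`; see the module docstring. Not to be
re-vendored as a named fact. [cite: CarlenJauslinLieb2021, Theorem 2] -/
theorem not_CarlenJauslinLieb2021_thm2 :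
    ¬ ∀ (v : Space → ℝ), IsWeightedPotential v → 0 < ∫ x, v x →
        (∀ (ρ e : ℝ) (u : Space → ℝ), 0 < ρ → 0 < e → IsSolution v ρ e u →
          decayBeta v ρ u ≤ ρ * ∫ x, ‖x‖ ^ 2 * v x ∧
          MemLp (fun x => ‖x‖ ^ 4 * decayRemainder v ρ e u x) 2 ∧
          MemLp (fun x => ‖x‖ ^ 4 * decayRemainder v ρ e u x) ∞) ∧
        (∀ ρ₀ : ℝ, 0 < ρ₀ → ∃ C : ℝ,
          ∀ (ρ e : ℝ) (u : Space → ℝ), 0 < ρ → ρ < ρ₀ → 0 < e → IsSolution v ρ e u →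
            ∀ x : Space, ρ * Real.sqrt e * ‖x‖ ^ 4 * u x ≤ C) :=
  not_CarlenJauslinLieb2021_thm2_of_thm1 CarlenJauslinLieb2020_thm1_holds

/-- **The false conjunct, exhibited**: for the CJL-II potential `v = 𝟙_{|x| ≤ 1}` there is a
solution triple `(ρ, 1, u)`, `ρ > 0`, of the simple equation (CJL-I Theorem 1) whose printed
remainder `R = ρu − √(2+β)/(2π²√e)|x|⁻⁴` does NOT satisfy `|x|⁴R ∈ L²(ℝ³)` (the solution is even
by uniqueness, and any `L²` tail constant of an even solution triple is `√(2 + β/3)/(2π²√e)`,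
`IsSolution.not_memLp_decayRemainder`). [cite: CarlenJauslinLieb2021, Theorem 2] -/
theorem exists_isSolution_not_memLp_two_decayRemainder :
    ∃ (v : Space → ℝ) (ρ : ℝ) (u : Space → ℝ), IsWeightedPotential v ∧ 0 < ∫ x, v x ∧ 0 < ρ ∧
      IsSolution v ρ 1 u ∧ ¬ MemLp (fun x => ‖x‖ ^ 4 * decayRemainder v ρ 1 u x) 2 := by
  set v : Space → ℝ := (Metric.closedBall (0 : Space) 1).indicator fun _ => (1 : ℝ) with hv_def
  have hv : IsWeightedPotential v := isWeightedPotential_indicator_closedBall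
  have hpos : 0 < ∫ x, v x := integral_indicator_closedBall_pos
  have hveven : ∀ x, v (-x) = v x := fun x => hv.radial (norm_neg x)
  obtain ⟨ρf, -, -, -, hρf⟩ := CarlenJauslinLieb2020_thm1_holds v 2 three_halves_lt_two hv.nonneg
    hv.integrable_self hv.memLp_two_self hpos
  obtain ⟨huniq, -⟩ := hρf 1 one_pos
  obtain ⟨u, hu⟩ := huniq.exists
  have hρpos : 0 < ρf 1 := hu.density_pos hv.nonneg one_pos
  have heven : ∀ x, u (-x) = u x := even_of_existsUnique hveven huniq hu
  exact ⟨v, ρf 1, u, hv, hpos, hρpos, hu, hu.not_memLp_decayRemainder hv hρpos one_pos heven⟩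

/-- **The tree's first rendering of CJL-II Theorem 6 is false.** CJL-II Theorem 6 — "Assume that
`(1 + |x|⁴)v ∈ L¹(ℝ³) ∩ L²(ℝ³)`. The non-condensed fraction `η` defined in (eta)
[`η = ∂_μ e_μ|_{μ=0}`] satisfies `η = ρ∫v𝔎_e u / (1 − ρ∫v𝔎_e(2u − ρu∗u))`. As `ρ → 0`, `η` goes to
`0` asymptotically as `η ∼ 8√(ρa₀³)/(3√π)` where `a₀` is the scattering length of `v`" — was first
rendered with `η = eta v ρ = deriv (μ ↦ pinnedEnergy v ρ μ) 0`, the TWO-SIDED derivative of the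
tree's least-energy selection, in the window `0 < e < e⋆` (the asymptotics uniform over solution
triples, `a₀ = scatteringLengthOf v φ` for a scattering solution `φ`, as in
`CarlenJauslinLieb2020_thm2`). That rendering is stated here verbatim in the type (exactly the body
of the retired named fact `CarlenJauslinLieb2021_thm6`) and REFUTED outright: the pinned system has
no solution for `μ < 0`, so `eta ≡ 0` (`eta_eq_zero`), and CJL-I Theorem 1
(`CarlenJauslinLieb2020_thm1_holds`) then refutes the asymptotic clause
(`not_CarlenJauslinLieb2021_thm6_of_thm1`, `LiebSimpleEquationPinned.lean`). The defect is the
rendering, not the printed theorem: CJL's `∂_μ|₀` is a right derivative along the pinned branch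
`μ ≥ 0`; the corrected rendering is recorded in Lean in the module docstring of the facts file, to
be vendored as `CarlenJauslinLieb2021_thm6_rightDeriv`. Not to be re-vendored in this form.
[cite: CarlenJauslinLieb2021, Theorem 6] -/
theorem not_CarlenJauslinLieb2021_thm6 :
    ¬ ∀ (v : Space → ℝ), IsWeightedPotential v → 0 < ∫ x, v x →
        (∀ (ρ e : ℝ) (u : Space → ℝ), 0 < ρ → 0 < e → e < eStar v → IsSolution v ρ e u →
          eta v ρ = etaFormula v ρ e u) ∧
        (∃ φ : Space → ℝ, IsScatteringSolution v φ ∧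
          ∀ ε : ℝ, 0 < ε → ∃ ρ₀ : ℝ, 0 < ρ₀ ∧
            ∀ (ρ e : ℝ) (u : Space → ℝ), 0 < ρ → ρ < ρ₀ → 0 < e → IsSolution v ρ e u →
              |eta v ρ - 8 * Real.sqrt (ρ * scatteringLengthOf v φ ^ 3) / (3 * Real.sqrt Real.pi)|
                ≤ ε * (8 * Real.sqrt (ρ * scatteringLengthOf v φ ^ 3) /
                  (3 * Real.sqrt Real.pi))) :=
  not_CarlenJauslinLieb2021_thm6_of_thm1 CarlenJauslinLieb2020_thm1_holds

/-! ## Cross-check: the explicit solution of CJL-II Theorem 8 (§10)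

For `e, b, c > 0` with `e/b² ≥ 7/9`, `c ≤ 1`: `u(x) = c/(1 + b²x²)²` solves the simple equation
with `ρ = b³/(cπ²)` ((rho)) and the potential (v_explicit); §10 prints `β = 6(2e − b²)/b²`
((beta_explicit), computed from (betadef)) and `u ∼ c/(b⁴x⁴)` ((asymu)), i.e. `ρu ∼ (ρc/b⁴)|x|⁻⁴`.
The established coefficient `√(2 + β/3)/(2π²√e)` equals `ρc/b⁴` identically; the printed
`√(2 + β)/(2π²√e)` equals it iff `2e = b²` (§10: "if and only if `2e = b²`"), a line excluded by
`e/b² ≥ 7/9`. -/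

/-- **The established coefficient reproduces the tail of the explicit solution exactly**: with
`ρ = b³/(cπ²)` and `β = 6(2e − b²)/b²` (CJL-II §10, (rho) and (beta_explicit)),
`√(2 + β/3)/(2π²√e) = ρ·c/b⁴`, the true coefficient of the `|x|⁻⁴` tail of `ρu` ((asymu)), for
all `e, b, c > 0`. [cite: CarlenJauslinLieb2021, Theorem 8 and §10] -/
theorem explicitSolution_correctedDecayCoeff_eq {e b c ρ β : ℝ} (he : 0 < e) (hb : 0 < b)
    (hc : 0 < c) (hρ : ρ = b ^ 3 / (c * Real.pi ^ 2)) (hβ : β = 6 * (2 * e - b ^ 2) / b ^ 2) :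
    Real.sqrt (2 + β / 3) / (2 * Real.pi ^ 2 * Real.sqrt e) = ρ * c / b ^ 4 := by
  subst hρ hβ
  have hπ : Real.pi ≠ 0 := Real.pi_ne_zero
  have hb0 : b ≠ 0 := hb.ne'
  have hc0 : c ≠ 0 := hc.ne'
  have hse : 0 < Real.sqrt e := Real.sqrt_pos.mpr he
  have hse0 : Real.sqrt e ≠ 0 := hse.ne'
  have h1 : 2 + 6 * (2 * e - b ^ 2) / b ^ 2 / 3 = (2 * Real.sqrt e / b) ^ 2 := by
    rw [div_pow, mul_pow, Real.sq_sqrt he.le]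
    field_simp
    ring
  rw [h1, Real.sqrt_sq (by positivity)]
  field_simp

/-- **The printed coefficient reproduces it only on the excluded line `2e = b²`**: with
`ρ = b³/(cπ²)`, `β = 6(2e − b²)/b²` and `e/b² ≥ 7/9` (the hypothesis (cond_explicit) of CJL-II
Theorem 8, under which `2 + β ≥ 0`), `√(2 + β)/(2π²√e) = ρ·c/b⁴ ↔ 2e = b²` — the "if and only if
`2e = b²`" of §10, there read as Theorem 2 not applying (`∫|x|⁴v = ∞`), here the symptom of the
factor `3` in (betadef). [cite: CarlenJauslinLieb2021, Theorem 8 and §10] -/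
theorem explicitSolution_decayCoeff_eq_iff {e b c ρ β : ℝ} (he : 0 < e) (hb : 0 < b) (hc : 0 < c)
    (heb : 7 / 9 ≤ e / b ^ 2) (hρ : ρ = b ^ 3 / (c * Real.pi ^ 2))
    (hβ : β = 6 * (2 * e - b ^ 2) / b ^ 2) :
    Real.sqrt (2 + β) / (2 * Real.pi ^ 2 * Real.sqrt e) = ρ * c / b ^ 4 ↔ 2 * e = b ^ 2 := by
  subst hρ hβ
  have hπ : Real.pi ≠ 0 := Real.pi_ne_zero
  have hb0 : b ≠ 0 := hb.ne'
  have hc0 : c ≠ 0 := hc.ne'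
  have hse : 0 < Real.sqrt e := Real.sqrt_pos.mpr he
  have hse0 : Real.sqrt e ≠ 0 := hse.ne'
  have hb2 : 0 < b ^ 2 := by positivity
  have heb' : 7 / 9 * b ^ 2 ≤ e := by rwa [le_div_iff₀ hb2] at heb
  have hA : 2 + 6 * (2 * e - b ^ 2) / b ^ 2 = (12 * e - 4 * b ^ 2) / b ^ 2 := by
    field_simp
    ring
  have hApos : 0 ≤ 2 + 6 * (2 * e - b ^ 2) / b ^ 2 := by
    rw [hA]
    exact div_nonneg (by nlinarith) hb2.le
  have hD : 0 < 2 * Real.pi ^ 2 * Real.sqrt e := by positivity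
  have hR : b ^ 3 / (c * Real.pi ^ 2) * c / b ^ 4 * (2 * Real.pi ^ 2 * Real.sqrt e) =
      2 * Real.sqrt e / b := by
    field_simp
  rw [div_eq_iff hD.ne', hR]
  constructor
  · intro h
    have h2 : Real.sqrt (2 + 6 * (2 * e - b ^ 2) / b ^ 2) ^ 2 = (2 * Real.sqrt e / b) ^ 2 := by
      rw [h]
    rw [Real.sq_sqrt hApos, div_pow, mul_pow, Real.sq_sqrt he.le, hA,
      div_eq_div_iff hb2.ne' hb2.ne'] at h2
    nlinarith [h2, hb2]
  · intro h
    have h1 : 2 + 6 * (2 * e - b ^ 2) / b ^ 2 = (2 * Real.sqrt e / b) ^ 2 := by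
      rw [div_pow, mul_pow, Real.sq_sqrt he.le, hA, div_eq_div_iff hb2.ne' hb2.ne']
      nlinarith [h]
    rw [h1, Real.sqrt_sq (by positivity)]

end LiebSimpleEquation

end Literature.MathematicalPhysics.QuantumManyBody

end
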